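import Summits.BirchSwinnertonDyer.Rank1Residual.Additive.X4TamDefectMazurPrincipleOnCycles
import Summits.BirchSwinnertonDyer.Rank1Residual.X4.KimDefectLevelLoweringRankOne
import HarnessLib

/-!
# The RANK-ONE Tamagawa rows from MAZUR'S PRINCIPLE ON CYCLES (cell `b2b-bsdres`, seat additive-p4, line V45)

HONEST FRAMING (verbatim, cell `b2b-bsdres`): the goal of the cell is to DELETE the COMBINATION-SHAPED
residual classes for ALL analytic-rank `≤ 1` curves over `ℚ` — "full BSD formula for every rank `≤ 1`
curve in class `C`" assembled STRICTLY from published theorems — so that the rank-`≤ 1` remainder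
becomes exactly the CONSTRUCTION-SHAPED classes, which are TYPED (missing-input Props), NOT attempted;
this is not "finishing BSD". This file: END theorems only (0 defs, 0 facts), nothing booked; X4
CONSTRUCTION-SHAPED; per pair (one Kurihara number each), modulo ONE typed target.

## What is proved

Gen 22's rank-one consumers of the level-lowering certificate (`X4/KimDefectLevelLoweringRankOne`:
under `PlusSymbolLevelLowersAt`, `∂^{(∞)} ≥ 1`, so ONE Kurihara number `δ̃_ℓ ≢ 0 (mod p²)` at a cyclic
level-`2` Kolyvagin prime closes a unit row Cassels–Tate-free, and ONE `δ̃_ℓ ≢ 0 (mod p³)` closes an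
`ord_p ∏c = 2` row with Cassels–Tate) RE-KEYED over the V45 target: the certificate is now the kernel
theorem `plusSymbolLevelLowersAt_of_oldOnCycles` (Mazur's principle ON CYCLES + Ihara's lemma BY NAME +
the non-Eisenstein numeral `q₀`). Census (V43, unchanged): at `p ≥ 5` the rank-one TAM rows are
469/470 Mazur-principle rows; at `p = 3`, 6 476/8 465.

* `X4.bsdp_rankOne_of_oldOnCycles_levelTwo_of_shaAn_unit_of_five_le` — `p ≥ 5`, `r_an = 1`, E73
  (`hE73`, Kim 2026 Thm. 1.8 (6) rank-one clause), GZK, modularity, `ρ̄` + tower onto, conductor-level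
  datum at `N = Mℓ` with `p ∤ c_D` + period transfer, split `ℓ₀ ∤ M` with `p ∣ c_{ℓ₀}` and non-scalar
  Frobenius, the numeral `q₀`, Ihara BY NAME, the target at `(W, p, ℓ₀, D.f)`, ONE `δ̃_ℓ ≢ 0 (mod p²)`
  at a cyclic `ℓ ∈ 𝒫₂`, `#Ш_an` a `p`-unit ⟹ `BSD(E,p)`.
* `X4.bsdp_rankOne_of_oldOnCycles_levelThree_of_casselsTate_of_shaAn_unit_of_five_le` — the
  level-THREE + Cassels–Tate twin.

## References

* C.-H. Kim, Amer. J. Math. 148 (2026), Thm. 1.9 (6). [cite: Kim2022StructureSelmer, Thm. 1.9 (6) (PDF p. 8)]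
* K. Ribet, W. Stein, *Lectures on Serre's conjectures* (2001), Thm. 3.14. [cite: RibetStein2001, Thm. 3.14 and Lemma 3.17]
* K. A. Ribet, Proc. ICM 1983 (1984), Thm. 4.1. [cite: Ribet1984ICM, Thm. 4.1]
* R. L. Miller, LMS J. Comput. Math. 14 (2011), Def. 1.1. [cite: Miller2011LMS, Def. 1.1]
-/

noncomputable section

open scoped MatrixGroups ModularForm Classical

open CongruenceSubgroup Finset

open Literature.NumberTheory.EllipticCurves Literature.NumberTheory.EllipticCurves.ModularForms

namespace Summit.BirchSwinnertonDyer.Rank1Residual.X4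

open Complex WeierstrassCurve Literature.NumberTheory.EllipticCurves.Rank1Residual
  Literature.NumberTheory.EllipticCurves.Rank1Residual.Typed
  Summit.BirchSwinnertonDyer.Rank1Residual.LevelLowering

variable (W : WeierstrassCurve ℚ) [W.IsElliptic] [W.IsGloballyMinimal] (p : ℕ) [Fact p.Prime]

/-- **RANK ONE, `p ≥ 5`, level TWO, Cassels–Tate-free, from MAZUR'S PRINCIPLE ON CYCLES.** E73
(`hE73`), GZK, modularity, `ρ̄_{E,p}` + tower onto, `r_an = 1`, conductor-level datum `D` at level
`Mℓ₀ = N` with `p ∤ c_D` + period transfer, `p` odd with a split multiplicative `ℓ₀ ∤ M` carrying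
`p ∣ c_{ℓ₀}` and non-scalar Frobenius, the numeral prime `q₀ ≡ 1 (mod Mℓ₀)` with
`a_{q₀} ≢ q₀ + 1 (mod p)`, Ihara's lemma BY NAME, the typed target `MazurPrincipleOldOnCycles W p ℓ₀ D.f`,
ONE `δ̃_ℓ ≢ 0 (mod p²)` at a cyclic `ℓ ∈ 𝒫₂`, `#Ш_an` a `p`-unit ⟹ `BSD(E,p)`. Per pair; nothing
booked. [cite: Kim2022StructureSelmer, Thm. 1.9 (6) (PDF p. 8)] [cite: RibetStein2001, Thm. 3.14 and Lemma 3.17]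
[cite: Ribet1984ICM, Thm. 4.1] [cite: Miller2011LMS, Def. 1.1] -/
theorem bsdp_rankOne_of_oldOnCycles_levelTwo_of_shaAn_unit_of_five_le
    (hI : ribet1984_iharaLemma)
    (hE73 : Kim2026.kuriharaPartial_vanishingOrder_eq_padicValNat_sha_add_partialInfty_of_maninConstant)
    (hGZK : rank_eq_analyticRank_of_analyticRank_le_one) (hmod : hasEntireLFunction_rat)
    (hp : 5 ≤ p) (hsurj : W.HasSurjectiveModNGaloisRep p)
    (htower : ∀ n : ℕ, W.HasSurjectiveModNGaloisRep (p ^ n : ℕ)) (hr : W.analyticRank = 1)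
    {M : ℕ} [NeZero M] {ℓ₀ : ℕ} [Fact ℓ₀.Prime] [NeZero (M * ℓ₀)]
    (D : ModularParametrizationData W (M * ℓ₀)) (hN : W.conductorNorm ℤ = M * ℓ₀)
    (hc : ¬ (p : ℤ) ∣ D.maninConstant)
    (hper : ∃ u : ℚ, ‖(u : ℚ_[p])‖ = 1 ∧ W.realPeriodRat = u * plusPeriod D.f)
    (hℓ₀p : ℓ₀ ≠ p) (hℓ₀M : ¬ ℓ₀ ∣ M) (hsplit : W.HasSplitMultiplicativeReductionAtPrime ℓ₀)
    (hcℓ₀ : p ∣ (W.baseChange ℚ_[ℓ₀]).localTamagawaNumber ℤ_[ℓ₀])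
    (hns : ¬ ℓ₀ ≡ 1 [MOD p] ∨
      Nat.card {P : (W.baseChange ℚ_[ℓ₀]).toAffine.Point // p • P = 0} ≠ p ^ 2)
    {q₀ : ℕ} (hq₀ : q₀.Prime) (hq₀1 : q₀ ≡ 1 [MOD M * ℓ₀])
    (haq₀ : ((W.LFunction q₀ : ℤ) : ZMod p) ≠ q₀ + 1)
    (hOC : MazurPrincipleOldOnCycles W p ℓ₀ D.f)
    (ℓ : ℕ) [Fact ℓ.Prime] (hℓ : Kato.IsKolyvaginPrime W p 2 ℓ)
    (hcyc : Nat.card {P : ((WeierstrassCurve.integralModelInt W).map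
        (Int.castRingHom (ZMod ℓ))).toAffine.Point // p • P = 0} ≤ p)
    (ψ : (ℓ' : ℕ) → (ZMod ℓ')ˣ →* Multiplicative (ZMod (p ^ 2)))
    (hψ : Function.Surjective (ψ ℓ)) (hδ : kuriharaNumber D.f (p ^ 2) ℓ ψ ≠ 0)
    {q : ℚ} (hq : shaAn W = (q : ℂ)) (hv : padicValRat p q = 0) : BSDp W p := by
  have hirr := hasIrreducibleModPGaloisRep_of_hasSurjectiveModNGaloisRep W p hsurj
  have hcert : PlusSymbolLevelLowersAt W p D.f ℓ₀ :=
    plusSymbolLevelLowersAt_of_oldOnCycles hI D.isNewformOf hN (by omega) hirr hℓ₀M hsplit hq₀ hq₀1 haq₀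
      (hOC D.isNewformOf hN (by omega) hirr hℓ₀p hℓ₀M hsplit hcℓ₀ hns)
  have hℓ₀N : ℓ₀ ∣ W.conductorNorm ℤ := by rw [hN]; exact dvd_mul_left ℓ₀ M
  exact bsdp_of_plusSymbolLevelLowersAt_levelTwo_rankOne_of_shaAn_unit_of_five_le W p hE73 hGZK hmod hp
    hsurj htower hr D hN hc hper hcert hℓ₀N ℓ hℓ hcyc ψ hψ hδ hq hv

/-- **RANK ONE, `p ≥ 5`, level THREE + Cassels–Tate, from MAZUR'S PRINCIPLE ON CYCLES** (the
`ord_p ∏c = 2` rows): as above with `hCT` and ONE `δ̃_ℓ ≢ 0 (mod p³)` at a cyclic `ℓ ∈ 𝒫₃`. Per pair;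
nothing booked. [cite: Kim2022StructureSelmer, Thm. 1.9 (6) (PDF p. 8)] [cite: RibetStein2001, Thm. 3.14 and Lemma 3.17]
[cite: Ribet1984ICM, Thm. 4.1] [cite: SilvermanAEC2009, Thm. X.4.14] [cite: Miller2011LMS, Def. 1.1] -/
theorem bsdp_rankOne_of_oldOnCycles_levelThree_of_casselsTate_of_shaAn_unit_of_five_le
    (hI : ribet1984_iharaLemma)
    (hE73 : Kim2026.kuriharaPartial_vanishingOrder_eq_padicValNat_sha_add_partialInfty_of_maninConstant)
    (hCT : exists_casselsTate_pairing (K := ℚ))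
    (hGZK : rank_eq_analyticRank_of_analyticRank_le_one) (hmod : hasEntireLFunction_rat)
    (hp : 5 ≤ p) (hsurj : W.HasSurjectiveModNGaloisRep p)
    (htower : ∀ n : ℕ, W.HasSurjectiveModNGaloisRep (p ^ n : ℕ)) (hr : W.analyticRank = 1)
    {M : ℕ} [NeZero M] {ℓ₀ : ℕ} [Fact ℓ₀.Prime] [NeZero (M * ℓ₀)]
    (D : ModularParametrizationData W (M * ℓ₀)) (hN : W.conductorNorm ℤ = M * ℓ₀)
    (hc : ¬ (p : ℤ) ∣ D.maninConstant)
    (hper : ∃ u : ℚ, ‖(u : ℚ_[p])‖ = 1 ∧ W.realPeriodRat = u * plusPeriod D.f)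
    (hℓ₀p : ℓ₀ ≠ p) (hℓ₀M : ¬ ℓ₀ ∣ M) (hsplit : W.HasSplitMultiplicativeReductionAtPrime ℓ₀)
    (hcℓ₀ : p ∣ (W.baseChange ℚ_[ℓ₀]).localTamagawaNumber ℤ_[ℓ₀])
    (hns : ¬ ℓ₀ ≡ 1 [MOD p] ∨
      Nat.card {P : (W.baseChange ℚ_[ℓ₀]).toAffine.Point // p • P = 0} ≠ p ^ 2)
    {q₀ : ℕ} (hq₀ : q₀.Prime) (hq₀1 : q₀ ≡ 1 [MOD M * ℓ₀])
    (haq₀ : ((W.LFunction q₀ : ℤ) : ZMod p) ≠ q₀ + 1)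
    (hOC : MazurPrincipleOldOnCycles W p ℓ₀ D.f)
    (ℓ : ℕ) [Fact ℓ.Prime] (hℓ : Kato.IsKolyvaginPrime W p 3 ℓ)
    (hcyc : Nat.card {P : ((WeierstrassCurve.integralModelInt W).map
        (Int.castRingHom (ZMod ℓ))).toAffine.Point // p • P = 0} ≤ p)
    (ψ : (ℓ' : ℕ) → (ZMod ℓ')ˣ →* Multiplicative (ZMod (p ^ 3)))
    (hψ : Function.Surjective (ψ ℓ)) (hδ : kuriharaNumber D.f (p ^ 3) ℓ ψ ≠ 0)
    {q : ℚ} (hq : shaAn W = (q : ℂ)) (hv : padicValRat p q = 0) : BSDp W p := by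
  have hirr := hasIrreducibleModPGaloisRep_of_hasSurjectiveModNGaloisRep W p hsurj
  have hcert : PlusSymbolLevelLowersAt W p D.f ℓ₀ :=
    plusSymbolLevelLowersAt_of_oldOnCycles hI D.isNewformOf hN (by omega) hirr hℓ₀M hsplit hq₀ hq₀1 haq₀
      (hOC D.isNewformOf hN (by omega) hirr hℓ₀p hℓ₀M hsplit hcℓ₀ hns)
  have hℓ₀N : ℓ₀ ∣ W.conductorNorm ℤ := by rw [hN]; exact dvd_mul_left ℓ₀ M
  exact bsdp_of_plusSymbolLevelLowersAt_levelThree_rankOne_of_casselsTate_of_shaAn_unit_of_five_le W p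
    hE73 hCT hGZK hmod hp hsurj htower hr D hN hc hper hcert hℓ₀N ℓ hℓ hcyc ψ hψ hδ hq hv

end Summit.BirchSwinnertonDyer.Rank1Residual.X4

end
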